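import Mathlib.Analysis.Complex.Polynomial.Basic
import Mathlib.Tactic.ComputeDegree
import Literature.Algebra.Polynomial.QPalindromicRealCounterpart
import HarnessLib

/-!
# Weil `q`-polynomials versus totally real counterparts: Goresky–Tai 2017 Proposition 36 (1), (2)

Topic `Literature/Algebra/Polynomial`; THEOREMS ONLY (no definition, no instance, no named fact;
D-0026 net debt 0).  Lane `lit-hodgefound` (summit `HodgeConjecture`, Track 2 foundations library),
seat `lit-hodgefound-p15`, generation 56, row g56-#2; sequel of
`Literature.Algebra.Polynomial.QPalindromicRealCounterpart` (row g56-#1: the transform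
`𝒯_{q,n}(h) = Σ_{j ≤ n} b_j X^{n−j}(X²+q)^j = xⁿ h(x + q/x)` and Proposition 36, first part).

THE PRINT.  M. Goresky, Y.-S. Tai, *Real structures on ordinary Abelian varieties*, arXiv:1701.07742
[GoreskyTai2017RealStructuresOrdinary], App. §16 (held `paper:arxiv-1701.07742`, p0036–p0037), verbatim:

> §16.1 Let `π` be an algebraic integer. It is totally real if `ρ(π) ∈ ℝ` for every embedding
> `ρ : ℚ(π) → ℂ`. It is a Weil `q`-integer if `|ρ(π)|² = q` for every embedding `ρ : ℚ(π) → ℂ`. … A monic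
> polynomial `p(x) ∈ ℤ[x]` is totally real if all of its roots are totally real algebraic integers. A Weil
> `q`-polynomial is a monic polynomial `p(x) ∈ ℤ[x]` of even degree, all of whose roots are Weil
> `q`-integers. …
> §16.2 … It is easy to see that every Weil `q`-polynomial is `q`-palindromic but the converse is not
> generally true. Let `p(x) = ∏_{j=1}^{n}(x − α_j)(x − q/α_j)` be a `q`-palindromic polynomial with no
> real roots. Define the associated real counterpart `h(x) = ∏ (x − (α_j + q/α_j))` …
> **Proposition 36.** Fix `n, q ∈ ℤ` with `n > 0` and `q > 0`. … Moreover,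
> (1) A `q`-palindromic polynomial `p(x) ∈ ℤ[x]` of even degree is a Weil `q`-polynomial if and only if
> the corresponding polynomial `h(x)` is totally real.
> (2) A totally real polynomial `h(x) ∈ ℤ[x]` is the real counterpart to a Weil `q`-polynomial `p(x)`
> with no real roots if and only if the roots `β_1, β_2, ⋯, β_n ∈ ℝ` of `h(x)` satisfy `|β_i| < 2√q` for
> `i = 1, 2, ⋯, n`.
> (3) [ordinarity — NOT here.]
> *Proof.* … To verify statement (1) let `p(x)` be a Weil `q`-polynomial. … Every pair `{α, q/α}` of
> complex roots are necessarily complex conjugate hence `β = α + q/α` is real. … Conversely, given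
> `p(x)`, if the associated polynomial `h(x)` is totally real then for each root `β = α + q/α` of
> `h(x)`, the corresponding pair of roots `{α, q/α}` are both real or else they are complex conjugate,
> and if they are real then they are both equal to `±√q`. This implies that `p(x)` is a Weil
> `q`-polynomial. For part (2) of the proposition, each root `β_i ∈ ℝ` of `h(x)` is a sum
> `β_i = α_i + q/α_i` of complex conjugate roots of `p(x)`. Hence `α_i` and `q/α_i` are the two roots of
> the quadratic equation `x² − β_i x + q = 0` which has real solutions if and only if `β_i² − 4q ≥ 0`.
> Thus, `p(x)` has no real roots if and only if `|β_i| < 2√q` for `i = 1, 2, ⋯, n`.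

WHAT IS HERE, for `p = 𝒯_{q,n}(h)` over `ℂ` (`h ∈ ℂ[x]` monic of degree `n`, `q > 0` real; since the
coefficients of an integer polynomial are fixed by every embedding, «all roots are Weil `q`-integers»
for `p ∈ ℤ[x]` reads «every complex root `α` has `|α|² = q`», and «totally real» reads «every complex
root is real» — the `ℤ[x]` forms are §5):
* §1 the quadratic `x² − βx + q` over `ℂ` (`q > 0`): the two roots `α`, `β − α = q/α`; conjugation;
  **`normSq_eq_iff_of_quadratic`** — a root `α` has `|α|² = q` iff `β` is real with `β² ≤ 4q`;
  `four_mul_le_sq_of_real_root` (a real root forces `β² ≥ 4q`), `im_ne_zero_of_sq_lt`.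
* §2 roots of `p` versus roots of `h` (`mem_roots_transform_iff`, `quadratic_of_ne_zero`,
  `exists_mem_roots_transform`).
* §3 PROPOSITION 36 (1).  SCOPE NOTE: as printed — without the standing hypothesis «with no real
  roots» under which the real counterpart is introduced — (1) is false: `x² − 3x + 1` is `1`-palindromic
  in `ℤ[x]` with totally real counterpart `x − 3`, but its roots `(3 ± √5)/2` are not of absolute value
  `1` (`not_weil_transform_X_sub_three`; the printed «if they are real then they are both equal to ±√q»
  is where the argument needs the hypothesis).  PROVED here: the correct unconditional form
  **`weil_iff_totallyReal_bounded`** («every root of `p` has `|α|² = q`» ⟺ «every root `β` of `h` is real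
  with `β² ≤ 4q`» — the closed bound, cf. [Howe2021] p. 2 «all of its complex roots are real numbers
  that lie in the interval `[−2√q, 2√q]`»), and (1) VERBATIM under «`p` has no real roots»
  (**`weil_iff_totallyReal_of_no_real_roots`**).
* §4 PROPOSITION 36 (2): for totally real `h`, `p` has no real roots iff every root has `β² < 4q`
  (**`no_real_roots_iff_sq_lt`**), in which case `p` is a Weil `q`-polynomial
  (`weil_of_totallyReal_sq_lt`); packaged: `p` is Weil with no real roots iff `h` is totally real with
  all `β² < 4q` (**`weil_no_real_roots_iff`**).
* §5 the `ℤ[x]` forms of (1)–(2) for `p = 𝒯_{q,n}(h)`, `h ∈ ℤ[x]` monic, `q ∈ ℤ_{>0}`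
  (`int_weil_iff_totallyReal_bounded`, `int_weil_no_real_roots_iff`).
* §6 SCOPE NOTE on «every Weil `q`-polynomial is `q`-palindromic»: false as printed — `x² − q` (`q` a
  positive integer) is a Weil `q`-polynomial in the printed sense (roots `±√q`) that is not
  `q`-palindromic (`a₀ = −q ≠ q·a₂`): `weil_X_sq_sub_C`, `not_pal_X_sq_sub_C`. (True, and used in
  practice, for characteristic polynomials of Frobenius, where `±√q` have even multiplicity; not
  restated.)

## References
* [GoreskyTai2017RealStructuresOrdinary] M. Goresky, Y.-S. Tai, Real structures on ordinary Abelian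
  varieties, arXiv:1701.07742 (2017), App. §16.1–§16.2, Proposition 36 (1), (2) with proof (p0036–p0037).
* [Howe2021] E. W. Howe, Deducing information about curves over finite fields from their Weil
  polynomials, arXiv:2110.04221, §1 p. 2 (the real Weil polynomial; roots in `[−2√q, 2√q]`).
-/

open Polynomial Finset Complex
open scoped ComplexConjugate

namespace Literature.Algebra.Polynomial.RealCounterpartWeilPolynomial

open Literature.Algebra.Polynomial.QPalindromicRealCounterpart

/-! ## §1 The quadratic `x² − βx + q` over `ℂ` -/

/-- A root of `x² − βx + q` with `q ≠ 0` is non-zero. [cite: GoreskyTai2017RealStructuresOrdinary, App. §16.2 proof of Prop. 36 (2) «α_i and q/α_i are the two roots of the quadratic equation x² − β_i x + q = 0» (p0037)] -/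
theorem ne_zero_of_quadratic {β α q : ℂ} (hq : q ≠ 0) (hα : α ^ 2 - β * α + q = 0) : α ≠ 0 := by
  rintro rfl
  apply hq
  simpa using hα

/-- The other root: if `α` is a root of `x² − βx + q` then so is `β − α`, and `α(β − α) = q`
(so `β − α = q/α`). [cite: GoreskyTai2017RealStructuresOrdinary, App. §16.2 proof of Prop. 36 (2) «α_i and q/α_i are the two roots of the quadratic equation x² − β_i x + q = 0» (p0037)] -/
theorem quadratic_sub_root {β α q : ℂ} (hα : α ^ 2 - β * α + q = 0) :
    (β - α) ^ 2 - β * (β - α) + q = 0 ∧ α * (β - α) = q ∧ α + (β - α) = β := by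
  refine ⟨by linear_combination hα, by linear_combination -hα, by ring⟩

/-- For a root `α ≠ 0`: `q/α = β − α` and `α + q/α = β`. [cite: GoreskyTai2017RealStructuresOrdinary, App. §16.2 «β_i = α_i + q/α_i» (p0036)] -/
theorem div_eq_sub_of_quadratic {β α q : ℂ} (hα0 : α ≠ 0) (hα : α ^ 2 - β * α + q = 0) :
    q / α = β - α ∧ α + q / α = β := by
  have h1 : q / α = β - α := by
    rw [div_eq_iff hα0]; linear_combination hα
  exact ⟨h1, by rw [h1]; ring⟩

/-- The roots of `x² − βx + q` are exactly `α` and `β − α` (given one root `α`). [cite: GoreskyTai2017RealStructuresOrdinary, App. §16.2 proof of Prop. 36 (2) «the two roots of the quadratic equation» (p0037)] -/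
theorem eq_or_eq_of_quadratic {β α q x : ℂ} (hα : α ^ 2 - β * α + q = 0)
    (hx : x ^ 2 - β * x + q = 0) : x = α ∨ x = β - α := by
  have h : (x - α) * (x - (β - α)) = 0 := by linear_combination hx - hα
  rcases mul_eq_zero.mp h with h | h
  · exact Or.inl (sub_eq_zero.mp h)
  · exact Or.inr (sub_eq_zero.mp h)

/-- For real `β` and real `q`, complex conjugation permutes the roots of `x² − βx + q`.
[cite: GoreskyTai2017RealStructuresOrdinary, App. §16.2 proof of Prop. 36 (1) «the corresponding pair of roots {α, q/α} are both real or else they are complex conjugate» (p0036)] -/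
theorem conj_root_of_quadratic {β α : ℂ} {q : ℝ} (hβ : β.im = 0)
    (hα : α ^ 2 - β * α + q = 0) : (conj α) ^ 2 - β * conj α + q = 0 := by
  have h := congrArg conj hα
  rw [map_add, map_sub, map_mul, map_pow, conj_ofReal, conj_eq_iff_im.mpr hβ, map_zero] at h
  exact h

/-- **If a root `α` of `x² − βx + q` (`q > 0`) has `|α|² = q` then `β = α + ᾱ` is real and `β² ≤ 4q`.**
[cite: GoreskyTai2017RealStructuresOrdinary, App. §16.2 proof of Prop. 36 (1) «Every pair {α, q/α} of complex roots are necessarily complex conjugate hence β = α + q/α is real» (p0036)] -/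
theorem real_and_sq_le_of_normSq_eq {β α : ℂ} {q : ℝ} (hq : 0 < q) (hα : α ^ 2 - β * α + q = 0)
    (hn : normSq α = q) : β.im = 0 ∧ β.re ^ 2 ≤ 4 * q := by
  have hα0 : α ≠ 0 := ne_zero_of_quadratic (by exact_mod_cast hq.ne') hα
  have hdiv : (q : ℂ) / α = conj α := by
    rw [div_eq_iff hα0, ← hn, mul_comm, mul_conj]
  have hβ : β = α + conj α := by
    rw [← (div_eq_sub_of_quadratic hα0 hα).2, hdiv]
  have hre : β.re = 2 * α.re := by rw [hβ]; simp [two_mul]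
  refine ⟨by rw [hβ]; simp, ?_⟩
  rw [hre, ← hn, normSq_apply]
  nlinarith [sq_nonneg α.im]

/-- A REAL root `α` of `x² − βx + q` (`β` real) forces `β² ≥ 4q` (the discriminant).
[cite: GoreskyTai2017RealStructuresOrdinary, App. §16.2 proof of Prop. 36 (2) «which has real solutions if and only if β_i² − 4q ≥ 0» (p0037)] -/
theorem four_mul_le_sq_of_real_root {β α : ℂ} {q : ℝ} (hβ : β.im = 0) (hαr : α.im = 0)
    (hα : α ^ 2 - β * α + q = 0) : 4 * q ≤ β.re ^ 2 := by
  have h' : α.re * α.re - β.re * α.re + q = 0 := by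
    have h := congrArg Complex.re hα
    simpa [sq, mul_re, hβ, hαr] using h
  nlinarith [sq_nonneg (2 * α.re - β.re)]

/-- For real `β` with `β² < 4q` every root of `x² − βx + q` is non-real.
[cite: GoreskyTai2017RealStructuresOrdinary, App. §16.2 proof of Prop. 36 (2) «p(x) has no real roots if and only if |β_i| < 2√q» (p0037)] -/
theorem im_ne_zero_of_sq_lt {β α : ℂ} {q : ℝ} (hβ : β.im = 0) (hlt : β.re ^ 2 < 4 * q)
    (hα : α ^ 2 - β * α + q = 0) : α.im ≠ 0 := fun hαr =>
  absurd (four_mul_le_sq_of_real_root hβ hαr hα) (not_le.mpr hlt)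

/-- **Conversely: for real `β` with `β² ≤ 4q` (`q > 0`) every root `α` of `x² − βx + q` has `|α|² = q`**
(the roots are complex conjugate, or both equal to `±√q`).
[cite: GoreskyTai2017RealStructuresOrdinary, App. §16.2 proof of Prop. 36 (1) «the corresponding pair of roots {α, q/α} are both real or else they are complex conjugate, and if they are real then they are both equal to ±√q» (p0036)] -/
theorem normSq_eq_of_real_sq_le {β α : ℂ} {q : ℝ} (hβ : β.im = 0)
    (hle : β.re ^ 2 ≤ 4 * q) (hα : α ^ 2 - β * α + q = 0) : normSq α = q := by
  rcases eq_or_eq_of_quadratic hα (conj_root_of_quadratic hβ hα) with hc | hc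
  · -- `α` real: `β² = 4q`, `α = β/2`
    have hαr : α.im = 0 := conj_eq_iff_im.mp hc
    have h' : α.re * α.re - β.re * α.re + q = 0 := by
      have h := congrArg Complex.re hα
      simpa [sq, mul_re, hβ, hαr] using h
    rw [normSq_apply, hαr, mul_zero, add_zero]
    nlinarith [sq_nonneg (2 * α.re - β.re)]
  · -- `ᾱ = β − α = q/α`
    have h2 := (quadratic_sub_root hα).2.1
    rw [← hc, mul_conj] at h2
    exact_mod_cast h2

/-- **A root `α` of `x² − βx + q` (`q > 0`) has `|α|² = q` iff `β` is real with `β² ≤ 4q`.**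
[cite: GoreskyTai2017RealStructuresOrdinary, App. §16.2 proof of Prop. 36 (1)–(2) (p0036–p0037)] -/
theorem normSq_eq_iff_of_quadratic {β α : ℂ} {q : ℝ} (hq : 0 < q) (hα : α ^ 2 - β * α + q = 0) :
    normSq α = q ↔ β.im = 0 ∧ β.re ^ 2 ≤ 4 * q :=
  ⟨real_and_sq_le_of_normSq_eq hq hα, fun h => normSq_eq_of_real_sq_le h.1 h.2 hα⟩

/-- Non-real roots with real `β`: `|α|² = q` (the pair `{α, q/α}` is complex conjugate).
[cite: GoreskyTai2017RealStructuresOrdinary, App. §16.2 proof of Prop. 36 (1) «or else they are complex conjugate» (p0036)] -/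
theorem normSq_eq_of_real_of_im_ne_zero {β α : ℂ} {q : ℝ} (hβ : β.im = 0) (hαi : α.im ≠ 0)
    (hα : α ^ 2 - β * α + q = 0) : normSq α = q := by
  rcases eq_or_eq_of_quadratic hα (conj_root_of_quadratic hβ hα) with hc | hc
  · exact absurd (conj_eq_iff_im.mp hc) hαi
  · have h2 := (quadratic_sub_root hα).2.1
    rw [← hc, mul_conj] at h2
    exact_mod_cast h2

/-- For real `β` with `β² ≥ 4q` the quadratic `x² − βx + q` has a real root, namely
`(β + √(β² − 4q))/2`. [cite: GoreskyTai2017RealStructuresOrdinary, App. §16.2 proof of Prop. 36 (2) «which has real solutions if and only if β_i² − 4q ≥ 0» (p0037)] -/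
theorem exists_real_root_of_sq_ge {β : ℂ} {q : ℝ} (hβ : β.im = 0) (hge : 4 * q ≤ β.re ^ 2) :
    ∃ α : ℂ, α.im = 0 ∧ α ^ 2 - β * α + q = 0 := by
  set s := Real.sqrt (β.re ^ 2 - 4 * q) with hs
  have hs2 : s * s = β.re ^ 2 - 4 * q := Real.mul_self_sqrt (by linarith)
  refine ⟨(((β.re + s) / 2 : ℝ) : ℂ), ofReal_im _, ?_⟩
  have hβ' : β = (β.re : ℂ) := by
    apply Complex.ext <;> simp [hβ]
  rw [hβ']
  norm_cast
  nlinarith [hs2]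

/-! ## §2 Roots of `p = 𝒯_{q,n}(h)` versus roots of `h` over `ℂ` -/

/-- The transform of a monic `h` of degree `n` is non-zero. [cite: GoreskyTai2017RealStructuresOrdinary, App. §16.2 «a monic polynomial p(x) = x^{2n} + …» (p0036)] -/
theorem transform_ne_zero {q : ℂ} (n : ℕ) {h : ℂ[X]} (hm : h.Monic) (hn : h.natDegree = n) :
    (∑ j ∈ Finset.range (n + 1), C (h.coeff j) * X ^ (n - j) * (X ^ 2 + C q) ^ j) ≠ 0 :=
  (monic_transform q n hm hn).1.ne_zero

/-- **Roots of `p` ↔ roots of `h`**: `α` is a root of `p` iff `α ≠ 0` and `α + q/α` is a root of `h`.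
[cite: GoreskyTai2017RealStructuresOrdinary, App. §16.2 «β_i = α_i + q/α_i» (p0036)] -/
theorem mem_roots_transform_iff {q : ℂ} (hq : q ≠ 0) (n : ℕ) {h : ℂ[X]} (hm : h.Monic)
    (hn : h.natDegree = n) (α : ℂ) :
    α ∈ (∑ j ∈ Finset.range (n + 1), C (h.coeff j) * X ^ (n - j) * (X ^ 2 + C q) ^ j).roots ↔
      α ≠ 0 ∧ α + q / α ∈ h.roots := by
  rw [mem_roots (transform_ne_zero n hm hn), mem_roots hm.ne_zero, isRoot_transform_iff hq n hm hn]

/-- A root `α` of `p` satisfies the quadratic `α² − βα + q = 0` with `β = α + q/α`.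
[cite: GoreskyTai2017RealStructuresOrdinary, App. §16.2 proof of Prop. 36 (2) «α_i and q/α_i are the two roots of the quadratic equation x² − β_i x + q = 0» (p0037)] -/
theorem quadratic_of_ne_zero {q α : ℂ} (hα0 : α ≠ 0) :
    α ^ 2 - (α + q / α) * α + q = 0 := by
  field_simp
  ring

/-- For every root `β` of `h` there is a root `α` of `p` with `α + q/α = β` (and `α² − βα + q = 0`).
[cite: GoreskyTai2017RealStructuresOrdinary, App. §16.2 «h(x) = ∏ (x − (α_j + q/α_j))» (p0036)] -/
theorem exists_mem_roots_transform {q : ℂ} (hq : q ≠ 0) (n : ℕ) {h : ℂ[X]} (hm : h.Monic)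
    (hn : h.natDegree = n) {β : ℂ} (hβ : β ∈ h.roots) :
    ∃ α : ℂ, α ∈ (∑ j ∈ Finset.range (n + 1),
        C (h.coeff j) * X ^ (n - j) * (X ^ 2 + C q) ^ j).roots ∧
      α ^ 2 - β * α + q = 0 ∧ α + q / α = β := by
  obtain ⟨α, hα⟩ := Complex.exists_root (f := X ^ 2 - C β * X + C q) (by
    have : (X ^ 2 - C β * X + C q : ℂ[X]).natDegree = 2 := by compute_degree!
    rw [degree_eq_natDegree (by rintro h0; rw [h0, natDegree_zero] at this; exact absurd this (by norm_num)), this]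
    norm_num)
  have hα' : α ^ 2 - β * α + q = 0 := by
    simpa [IsRoot.def, eval_add, eval_sub, eval_mul, eval_pow, eval_X, eval_C] using hα
  have hα0 := ne_zero_of_quadratic hq hα'
  refine ⟨α, ?_, hα', (div_eq_sub_of_quadratic hα0 hα').2⟩
  rw [mem_roots (transform_ne_zero n hm hn)]
  exact isRoot_transform_of_quadratic hq n hm hn ((mem_roots hm.ne_zero).mp hβ) hα'

/-! ## §3 Proposition 36 (1) -/

/-- **Proposition 36 (1), unconditional correct form** (`q > 0`, `h ∈ ℂ[x]` monic of degree `n`,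
`p = 𝒯_{q,n}(h) = xⁿh(x + q/x)`): every root `α` of `p` has `|α|² = q` iff every root `β` of `h` is
real with `β² ≤ 4q`. [cite: GoreskyTai2017RealStructuresOrdinary, App. §16.2 Prop. 36 (1) and proof (p0036)] [cite: Howe2021, §1 p. 2 «all of its complex roots are real numbers that lie in the interval [−2√q, 2√q]»] -/
theorem weil_iff_totallyReal_bounded {q : ℝ} (hq : 0 < q) (n : ℕ) {h : ℂ[X]} (hm : h.Monic)
    (hn : h.natDegree = n) :
    (∀ α ∈ (∑ j ∈ Finset.range (n + 1),
        C (h.coeff j) * X ^ (n - j) * (X ^ 2 + C (q : ℂ)) ^ j).roots, normSq α = q) ↔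
      ∀ β ∈ h.roots, β.im = 0 ∧ β.re ^ 2 ≤ 4 * q := by
  have hq' : (q : ℂ) ≠ 0 := by exact_mod_cast hq.ne'
  constructor
  · intro H β hβ
    obtain ⟨α, hαp, hαq, -⟩ := exists_mem_roots_transform hq' n hm hn hβ
    exact real_and_sq_le_of_normSq_eq hq hαq (H α hαp)
  · intro H α hα
    obtain ⟨hα0, hβ⟩ := (mem_roots_transform_iff hq' n hm hn α).mp hα
    obtain ⟨hβi, hβle⟩ := H _ hβ
    exact normSq_eq_of_real_sq_le hβi hβle (quadratic_of_ne_zero hα0)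

/-- **Proposition 36 (1) as printed, under the standing hypothesis «`p` has no real roots»**: then `p`
is a Weil `q`-polynomial (every root has `|α|² = q`) iff `h` is totally real.
[cite: GoreskyTai2017RealStructuresOrdinary, App. §16.2 Prop. 36 (1) «A q-palindromic polynomial p(x) ∈ ℤ[x] of even degree is a Weil q-polynomial if and only if the corresponding polynomial h(x) is totally real» (p0036)] -/
theorem weil_iff_totallyReal_of_no_real_roots {q : ℝ} (hq : 0 < q) (n : ℕ) {h : ℂ[X]}
    (hm : h.Monic) (hn : h.natDegree = n)
    (hnr : ∀ α ∈ (∑ j ∈ Finset.range (n + 1),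
        C (h.coeff j) * X ^ (n - j) * (X ^ 2 + C (q : ℂ)) ^ j).roots, α.im ≠ 0) :
    (∀ α ∈ (∑ j ∈ Finset.range (n + 1),
        C (h.coeff j) * X ^ (n - j) * (X ^ 2 + C (q : ℂ)) ^ j).roots, normSq α = q) ↔
      ∀ β ∈ h.roots, β.im = 0 := by
  have hq' : (q : ℂ) ≠ 0 := by exact_mod_cast hq.ne'
  constructor
  · intro H β hβ
    exact (((weil_iff_totallyReal_bounded hq n hm hn).mp H) β hβ).1
  · intro H α hα
    obtain ⟨hα0, hβ⟩ := (mem_roots_transform_iff hq' n hm hn α).mp hα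
    exact normSq_eq_of_real_of_im_ne_zero (H _ hβ) (hnr α hα) (quadratic_of_ne_zero hα0)

/-- SCOPE NOTE for (1) without the hypothesis «no real roots»: `x² − 3x + 1 = 𝒯_{1,1}(x − 3)` is
`1`-palindromic with integer coefficients and totally real counterpart `x − 3`, yet it has a root `α`
with `|α|² ≠ 1` (its roots `(3 ± √5)/2` are real, not `±1`). [cite: GoreskyTai2017RealStructuresOrdinary, App. §16.2 Prop. 36 (1) (p0036) — counterexample to the unqualified reading] -/
theorem not_weil_transform_X_sub_three :
    ∃ α ∈ (∑ j ∈ Finset.range (1 + 1),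
        C ((X - C (3 : ℂ)).coeff j) * X ^ (1 - j) * (X ^ 2 + C ((1 : ℝ) : ℂ)) ^ j).roots,
      normSq α ≠ (1 : ℝ) := by
  by_contra H
  push Not at H
  have h3 : (X - C (3 : ℂ)).natDegree = 1 := natDegree_X_sub_C 3
  have := (weil_iff_totallyReal_bounded (q := 1) one_pos 1 (monic_X_sub_C 3) h3).mp H 3
    (by rw [mem_roots (X_sub_C_ne_zero 3)]; simp)
  norm_num at this

/-! ## §4 Proposition 36 (2) -/

/-- **Proposition 36 (2)**: for a totally real monic `h` of degree `n` (`q > 0`), the polynomial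
`p = xⁿh(x + q/x)` has no real roots iff every root `β` of `h` satisfies `β² < 4q` (`|β| < 2√q`).
[cite: GoreskyTai2017RealStructuresOrdinary, App. §16.2 Prop. 36 (2) and proof «Thus, p(x) has no real roots if and only if |β_i| < 2√q» (p0036–p0037)] -/
theorem no_real_roots_iff_sq_lt {q : ℝ} (hq : 0 < q) (n : ℕ) {h : ℂ[X]} (hm : h.Monic)
    (hn : h.natDegree = n) (hreal : ∀ β ∈ h.roots, β.im = 0) :
    (∀ α ∈ (∑ j ∈ Finset.range (n + 1),
        C (h.coeff j) * X ^ (n - j) * (X ^ 2 + C (q : ℂ)) ^ j).roots, α.im ≠ 0) ↔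
      ∀ β ∈ h.roots, β.re ^ 2 < 4 * q := by
  have hq' : (q : ℂ) ≠ 0 := by exact_mod_cast hq.ne'
  constructor
  · intro H β hβ
    by_contra hge
    rw [not_lt] at hge
    obtain ⟨α, hαr, hαq⟩ := exists_real_root_of_sq_ge (hreal β hβ) hge
    have hαp : α ∈ (∑ j ∈ Finset.range (n + 1),
        C (h.coeff j) * X ^ (n - j) * (X ^ 2 + C (q : ℂ)) ^ j).roots := by
      rw [mem_roots (transform_ne_zero n hm hn)]
      exact isRoot_transform_of_quadratic hq' n hm hn ((mem_roots hm.ne_zero).mp hβ) hαq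
    exact H α hαp hαr
  · intro H α hα
    obtain ⟨hα0, hβ⟩ := (mem_roots_transform_iff hq' n hm hn α).mp hα
    exact im_ne_zero_of_sq_lt (hreal _ hβ) (H _ hβ) (quadratic_of_ne_zero hα0)

/-- For a totally real `h` with all `β² < 4q`, `p` is a Weil `q`-polynomial (every root has
`|α|² = q`). [cite: GoreskyTai2017RealStructuresOrdinary, App. §16.2 Prop. 36 (2) «the real counterpart to a Weil q-polynomial p(x) with no real roots» (p0036)] -/
theorem weil_of_totallyReal_sq_lt {q : ℝ} (hq : 0 < q) (n : ℕ) {h : ℂ[X]} (hm : h.Monic)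
    (hn : h.natDegree = n) (hreal : ∀ β ∈ h.roots, β.im = 0 ∧ β.re ^ 2 < 4 * q) :
    ∀ α ∈ (∑ j ∈ Finset.range (n + 1),
        C (h.coeff j) * X ^ (n - j) * (X ^ 2 + C (q : ℂ)) ^ j).roots, normSq α = q :=
  (weil_iff_totallyReal_bounded hq n hm hn).mpr fun β hβ => ⟨(hreal β hβ).1, (hreal β hβ).2.le⟩

/-- **Proposition 36 (2), packaged**: `p = xⁿh(x + q/x)` is a Weil `q`-polynomial with no real roots
iff `h` is totally real with every root satisfying `β² < 4q`.
[cite: GoreskyTai2017RealStructuresOrdinary, App. §16.2 Prop. 36 (2) (p0036)] -/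
theorem weil_no_real_roots_iff {q : ℝ} (hq : 0 < q) (n : ℕ) {h : ℂ[X]} (hm : h.Monic)
    (hn : h.natDegree = n) :
    (∀ α ∈ (∑ j ∈ Finset.range (n + 1),
        C (h.coeff j) * X ^ (n - j) * (X ^ 2 + C (q : ℂ)) ^ j).roots, normSq α = q ∧ α.im ≠ 0) ↔
      ∀ β ∈ h.roots, β.im = 0 ∧ β.re ^ 2 < 4 * q := by
  constructor
  · intro H
    have hreal : ∀ β ∈ h.roots, β.im = 0 := fun β hβ =>
      (((weil_iff_totallyReal_bounded hq n hm hn).mp fun α hα => (H α hα).1) β hβ).1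
    have hlt := (no_real_roots_iff_sq_lt hq n hm hn hreal).mp fun α hα => (H α hα).2
    exact fun β hβ => ⟨hreal β hβ, hlt β hβ⟩
  · intro H α hα
    exact ⟨weil_of_totallyReal_sq_lt hq n hm hn H α hα,
      (no_real_roots_iff_sq_lt hq n hm hn (fun β hβ => (H β hβ).1)).mpr (fun β hβ => (H β hβ).2) α hα⟩

/-! ## §5 The `ℤ[x]` forms (the printed setting `p, h ∈ ℤ[x]`, `q ∈ ℤ_{>0}`) -/

/-- The transform over `ℤ` maps to the transform over `ℂ`. [cite: GoreskyTai2017RealStructuresOrdinary, App. §16.2 Prop. 36 «universal … integer matrix A» (p0036)] -/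
theorem map_int_transform (q : ℤ) (n : ℕ) (h : ℤ[X]) :
    (∑ j ∈ Finset.range (n + 1), C (h.coeff j) * X ^ (n - j) * (X ^ 2 + C q) ^ j).map
        (Int.castRingHom ℂ) =
      ∑ j ∈ Finset.range (n + 1), C ((h.map (Int.castRingHom ℂ)).coeff j) * X ^ (n - j) *
        (X ^ 2 + C (((q : ℝ)) : ℂ)) ^ j := by
  rw [transform_map]
  simp

/-- **Proposition 36 (1)(2) over `ℤ[x]`, unconditional form**: for `h ∈ ℤ[x]` monic of degree `n`,
`q > 0` an integer and `p = 𝒯_{q,n}(h) ∈ ℤ[x]`, every complex root of `p` has `|α|² = q` (all roots are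
Weil `q`-integers) iff every complex root `β` of `h` is real with `β² ≤ 4q`.
[cite: GoreskyTai2017RealStructuresOrdinary, App. §16.2 Prop. 36 (1) (p0036)] [cite: Howe2021, §1 p. 2] -/
theorem int_weil_iff_totallyReal_bounded {q : ℤ} (hq : 0 < q) (n : ℕ) {h : ℤ[X]} (hm : h.Monic)
    (hn : h.natDegree = n) :
    (∀ α ∈ ((∑ j ∈ Finset.range (n + 1), C (h.coeff j) * X ^ (n - j) * (X ^ 2 + C q) ^ j).map
        (Int.castRingHom ℂ)).roots, normSq α = (q : ℝ)) ↔
      ∀ β ∈ (h.map (Int.castRingHom ℂ)).roots, β.im = 0 ∧ β.re ^ 2 ≤ 4 * (q : ℝ) := by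
  rw [map_int_transform]
  exact weil_iff_totallyReal_bounded (by exact_mod_cast hq) n (hm.map _)
    (by rw [natDegree_map_eq_of_injective Int.cast_injective, hn])

/-- **Proposition 36 (2) over `ℤ[x]`**: `p = 𝒯_{q,n}(h)` is a Weil `q`-polynomial with no real roots
iff `h` is totally real with all roots `|β_i| < 2√q`.
[cite: GoreskyTai2017RealStructuresOrdinary, App. §16.2 Prop. 36 (2) (p0036)] -/
theorem int_weil_no_real_roots_iff {q : ℤ} (hq : 0 < q) (n : ℕ) {h : ℤ[X]} (hm : h.Monic)
    (hn : h.natDegree = n) :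
    (∀ α ∈ ((∑ j ∈ Finset.range (n + 1), C (h.coeff j) * X ^ (n - j) * (X ^ 2 + C q) ^ j).map
        (Int.castRingHom ℂ)).roots, normSq α = (q : ℝ) ∧ α.im ≠ 0) ↔
      ∀ β ∈ (h.map (Int.castRingHom ℂ)).roots, β.im = 0 ∧ β.re ^ 2 < 4 * (q : ℝ) := by
  rw [map_int_transform]
  exact weil_no_real_roots_iff (by exact_mod_cast hq) n (hm.map _)
    (by rw [natDegree_map_eq_of_injective Int.cast_injective, hn])

/-! ## §6 Scope note: «every Weil `q`-polynomial is `q`-palindromic» fails for `x² − q` -/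

/-- `x² − q` (`q > 0`) is a Weil `q`-polynomial in the printed sense: monic of even degree with every
complex root of absolute value `√q`. [cite: GoreskyTai2017RealStructuresOrdinary, App. §16.1 «A Weil q-polynomial is a monic polynomial p(x) ∈ ℤ[x] of even degree, all of whose roots are Weil q-integers» (p0036)] -/
theorem weil_X_sq_sub_C {q : ℝ} (hq : 0 < q) :
    (X ^ 2 - C (q : ℂ) : ℂ[X]).Monic ∧ (X ^ 2 - C (q : ℂ) : ℂ[X]).natDegree = 2 ∧
      ∀ α ∈ (X ^ 2 - C (q : ℂ) : ℂ[X]).roots, normSq α = q := by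
  have hd : (X ^ 2 - C (q : ℂ) : ℂ[X]).natDegree = 2 := by compute_degree!
  have hm : (X ^ 2 - C (q : ℂ) : ℂ[X]).Monic := by
    unfold Monic leadingCoeff; rw [hd]; simp [coeff_X_pow]
  refine ⟨hm, hd, fun α hα => ?_⟩
  rw [mem_roots hm.ne_zero, IsRoot.def] at hα
  simp only [eval_sub, eval_pow, eval_X, eval_C, sub_eq_zero] at hα
  -- `α² = q` with `q > 0` real: `α = ±√q` is real and `|α|² = α²… = q`
  have him : α.im = 0 := by
    have h1 := congrArg Complex.im hα
    have h2 := congrArg Complex.re hα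
    simp only [sq, mul_im, ofReal_im] at h1
    simp only [sq, mul_re, ofReal_re] at h2
    have : 2 * α.re * α.im = 0 := by linarith
    rcases mul_eq_zero.mp this with h | h
    · rcases mul_eq_zero.mp h with h | h
      · norm_num at h
      · rw [h] at h2; nlinarith [sq_nonneg α.im]
    · exact h
  have h2 := congrArg Complex.re hα
  simp only [sq, mul_re, ofReal_re, him, mul_zero, sub_zero] at h2
  rw [normSq_apply, him, mul_zero, add_zero, h2]

/-- … but `x² − q ∈ ℤ[x]` is NOT `q`-palindromic for `q ≠ 0`: `a₀ = −q ≠ q·a₂` (the printed «every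
Weil q-polynomial is q-palindromic» needs the real roots `±√q` to have even multiplicity).
[cite: GoreskyTai2017RealStructuresOrdinary, App. §16.2 «It is easy to see that every Weil q-polynomial is q-palindromic» (p0036) — counterexample to the sentence as printed] -/
theorem not_pal_X_sq_sub_C {q : ℤ} (hq : q ≠ 0) :
    ¬ ∀ r ≤ 1, (X ^ 2 - C q : ℤ[X]).coeff (1 - r) = q ^ r * (X ^ 2 - C q : ℤ[X]).coeff (1 + r) := by
  intro H
  have h := H 1 le_rfl
  rw [Nat.sub_self, pow_one, coeff_sub, coeff_sub, coeff_X_pow, coeff_X_pow, coeff_C, coeff_C] at h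
  norm_num at h
  omega

end Literature.Algebra.Polynomial.RealCounterpartWeilPolynomial
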